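import Summits.NavierStokesRegularity.NavierStokesRegularity.Theses.QuarterTurnRdss
import Literature.Analysis.FluidPDE.TypeIAncientMild

/-!
# Line `no-satellites` (R) for the split piece `TwistedCellDecay` — crux `QuarterTurnProfileExists`
# (stmt-NavierStokesRegularity-1100), route `QuarterTurnRdss`, summit NavierStokesRegularity (negative side)

Second registered line for the ∀-piece of the period-cell split (crux-strategist seat
`cstrat-stmt-NavierStokesRegularity-1100-r1`); it covers the BLOW-UP world, where the cell is not zero and
the Type-I space–time bound must come from REGULARITY OFF THE ORIGIN AT THE FINAL TIME. Through the
twisted zoom, the bound `‖v(t,x)‖ ≤ C₀/(‖x‖ + √(-t))` on the period says exactly that the concatenated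
Type-I-in-time RDSS ancient solution `u` is bounded near every final-time point `x₀ ≠ 0` (its final-time
singular set is `{0}`: no `cR`-invariant spiral `{cᵏRᵏx₀}` of satellite Type-I singularities), i.e. in
cell terms that `‖x‖·‖v(t,x)‖` is bounded on the far shells `‖x‖ ≥ c^{k₀}`:

* `stub_eventual_shell_regularity` (XL, open core): for a quarter-turn twisted cell, `‖x‖‖v(t,x)‖ ≤ K`
  on `‖x‖ ≥ c^{k₀}` for some `k₀, K`. Intended mechanism: a scale-invariant FINITENESS statement for the
  final-time singular set — locally `L_∞(L^{3,∞})` solutions have finitely many singular points per time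
  (Seregin arXiv:1906.06707, after Choe–Wolf–Yang), and a finite `cR`-invariant subset of `ℝ³ ∖ {0}` is
  empty — followed by ε-regularity (CKN / Lin) on the compact shell `1 ≤ ‖x‖ ≤ c` near `t = 0` (tree:
  `LerayFarFieldEpsilonRegularity*`, `NSLocalLerayFarFieldRegular*`, `LocalTypeI*`). The missing input is
  the weak-`L³` control of the concatenated solution (or any other route to finiteness) — this is where
  the line is open.
* `stub_decay_of_eventual` (S/M, provable, elementary): boundedness by `M` on the near shells plus
  `K/‖x‖` on the far shells give the Type-I bound with `C₀ = max (2K) (max M 0 · (c^{k₀} + 1))`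
  (`√(-t) ≤ 1 ≤ c^{k₀} ≤ ‖x‖` on the far shells; `‖x‖ + √(-t) ≤ c^{k₀} + 1` on the near ones).

Composition `TwistedCellDecay_of` (kernel-checked): boundedness is a clause of the cell.

Until `route edit --split QuarterTurnProfileExists` has rendered the piece, the piece is the LOCAL verbatim
copy `TwistedCellDecay` below; afterwards replace it by the route decl (`Iff.rfl`).

Disproof used: none — no `Disproof.lean` / Negative lemma exists for this crux (`ledger crux ls`, 2026-08-17).
-/

noncomputable section

namespace Summit.NavierStokesRegularity.NavierStokesRegularity.Cruxes.TwistedCellDecay.NoSatellites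

open MeasureTheory Set Function Filter
open Literature.Analysis.FluidPDE

set_option linter.dupNamespace false

/-- LOCAL verbatim copy of the split piece `QuarterTurnRdss.TwistedCellDecay` (children.json). -/
def TwistedCellDecay : Prop :=
  ∀ c : ℝ, 1 < c → ∀ R : EuclideanSpace ℝ (Fin 3) ≃ₗᵢ[ℝ] EuclideanSpace ℝ (Fin 3), (∀ x : EuclideanSpace ℝ (Fin 3), (R x) 0 = -(x 1) ∧ (R x) 1 = x 0 ∧ (R x) 2 = x 2) → ∀ v : ℝ → EuclideanSpace ℝ (Fin 3) → EuclideanSpace ℝ (Fin 3), (ContinuousOn (Function.uncurry v) (Set.Icc (-1 : ℝ) (-(c ^ 2)⁻¹) ×ˢ Set.univ) ∧ (∃ M : ℝ, ∀ t ∈ Set.Icc (-1 : ℝ) (-(c ^ 2)⁻¹), ∀ x, ‖v t x‖ ≤ M) ∧ (∀ t ∈ Set.Icc (-1 : ℝ) (-(c ^ 2)⁻¹), Literature.Analysis.FluidPDE.IsWeaklyDivFree (v t)) ∧ (∀ s t : ℝ, -1 ≤ s → s < t → t ≤ -(c ^ 2)⁻¹ → ∀ x, v t x = Literature.Analysis.FluidPDE.heatFlow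 (v s) (t - s) x - Literature.Analysis.FluidPDE.oseenDuhamel 1 s v v t x) ∧ (∀ x, v (-(c ^ 2)⁻¹) x = c • R.symm (v (-1) (c • R x)))) → ∃ C₀ : ℝ, ∀ t ∈ Set.Icc (-1 : ℝ) (-(c ^ 2)⁻¹), ∀ x, ‖v t x‖ ≤ C₀ / (‖x‖ + Real.sqrt (-t))

/-- Statement of stub 1 (regularity off the origin at the final time, cell form). -/
def EventualShellRegularity : Prop :=
  ∀ c : ℝ, 1 < c → ∀ R : EuclideanSpace ℝ (Fin 3) ≃ₗᵢ[ℝ] EuclideanSpace ℝ (Fin 3), (∀ x : EuclideanSpace ℝ (Fin 3), (R x) 0 = -(x 1) ∧ (R x) 1 = x 0 ∧ (R x) 2 = x 2) → ∀ v : ℝ → EuclideanSpace ℝ (Fin 3) → EuclideanSpace ℝ (Fin 3), (ContinuousOn (Function.uncurry v) (Set.Icc (-1 : ℝ) (-(c ^ 2)⁻¹) ×ˢ Set.univ) ∧ (∃ M : ℝ, ∀ t ∈ Set.Icc (-1 : ℝ) (-(c ^ 2)⁻¹), ∀ x, ‖v t x‖ ≤ M) ∧ (∀ t ∈ Set.Icc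 (-1 : ℝ) (-(c ^ 2)⁻¹), Literature.Analysis.FluidPDE.IsWeaklyDivFree (v t)) ∧ (∀ s t : ℝ, -1 ≤ s → s < t → t ≤ -(c ^ 2)⁻¹ → ∀ x, v t x = Literature.Analysis.FluidPDE.heatFlow (v s) (t - s) x - Literature.Analysis.FluidPDE.oseenDuhamel 1 s v v t x) ∧ (∀ x, v (-(c ^ 2)⁻¹) x = c • R.symm (v (-1) (c • R x)))) → ∃ (k₀ : ℕ) (K : ℝ), ∀ t ∈ Set.Icc (-1 : ℝ) (-(c ^ 2)⁻¹), ∀ x, c ^ k₀ ≤ ‖x‖ → ‖x‖ * ‖v t x‖ ≤ K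

/-- Statement of stub 2 (near-shell bound + far-shell decay ⇒ Type-I bound on the period). -/
def DecayOfEventual : Prop :=
  ∀ c : ℝ, 1 < c → ∀ (v : ℝ → EuclideanSpace ℝ (Fin 3) → EuclideanSpace ℝ (Fin 3)) (M : ℝ) (k₀ : ℕ) (K : ℝ), (∀ t ∈ Set.Icc (-1 : ℝ) (-(c ^ 2)⁻¹), ∀ x, ‖v t x‖ ≤ M) → (∀ t ∈ Set.Icc (-1 : ℝ) (-(c ^ 2)⁻¹), ∀ x, c ^ k₀ ≤ ‖x‖ → ‖x‖ * ‖v t x‖ ≤ K) → ∃ C₀ : ℝ, (∀ t ∈ Set.Icc (-1 : ℝ) (-(c ^ 2)⁻¹), ∀ x, ‖v t x‖ ≤ C₀ / (‖x‖ + Real.sqrt (-t)))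

namespace Registered

/-- Alias keyed by the registered stub name. -/
abbrev stub_eventual_shell_regularity : Prop := EventualShellRegularity
/-- Alias keyed by the registered stub name. -/
abbrev stub_decay_of_eventual : Prop := DecayOfEventual

end Registered

/-- **Stub 1 (XL, open): regularity off the origin at the final time.** For `c > 1`, the quarter-turn `R`
and a twisted cell `v`, there are `k₀ : ℕ` and `K` with `‖x‖·‖v(t,x)‖ ≤ K` for all model times `t` and all
`‖x‖ ≥ c^{k₀}`. Why it might fail: a Type-I-in-time RDSS ancient solution could carry a `cR`-invariant spiral
of satellite Type-I singular points at `t = 0` (CKN allows countable final-time singular sets; finiteness is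
known only under an `L_∞(L^{3,∞})` bound).
[sources: arXiv:1906.06707 (Seregin 2019, after Choe–Wolf–Yang); CaffarelliKohnNirenberg1982; Lin1998; AlbrittonBarker2019; KNSS2009] -/
theorem stub_eventual_shell_regularity :
    ∀ c : ℝ, 1 < c → ∀ R : EuclideanSpace ℝ (Fin 3) ≃ₗᵢ[ℝ] EuclideanSpace ℝ (Fin 3), (∀ x : EuclideanSpace ℝ (Fin 3), (R x) 0 = -(x 1) ∧ (R x) 1 = x 0 ∧ (R x) 2 = x 2) → ∀ v : ℝ → EuclideanSpace ℝ (Fin 3) → EuclideanSpace ℝ (Fin 3), (ContinuousOn (Function.uncurry v) (Set.Icc (-1 : ℝ) (-(c ^ 2)⁻¹) ×ˢ Set.univ) ∧ (∃ M : ℝ, ∀ t ∈ Set.Icc (-1 : ℝ) (-(c ^ 2)⁻¹), ∀ x, ‖v t x‖ ≤ M) ∧ (∀ t ∈ Set.Icc (-1 : ℝ) (-(c ^ 2)⁻¹), Literature.Analysis.FluidPDE.IsWeaklyDivFree (v t)) ∧ (∀ s t : ℝ, -1 ≤ s → s < t → t ≤ -(c ^ 2)⁻¹ → ∀ x, v t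 x = Literature.Analysis.FluidPDE.heatFlow (v s) (t - s) x - Literature.Analysis.FluidPDE.oseenDuhamel 1 s v v t x) ∧ (∀ x, v (-(c ^ 2)⁻¹) x = c • R.symm (v (-1) (c • R x)))) → ∃ (k₀ : ℕ) (K : ℝ), ∀ t ∈ Set.Icc (-1 : ℝ) (-(c ^ 2)⁻¹), ∀ x, c ^ k₀ ≤ ‖x‖ → ‖x‖ * ‖v t x‖ ≤ K := by
  sorry

/-- **Stub 2 (S/M, provable): near-shell boundedness + far-shell decay ⇒ the Type-I bound on the period.**
[sources: elementary; KNSS2009 (1.6)] -/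
theorem stub_decay_of_eventual :
    ∀ c : ℝ, 1 < c → ∀ (v : ℝ → EuclideanSpace ℝ (Fin 3) → EuclideanSpace ℝ (Fin 3)) (M : ℝ) (k₀ : ℕ) (K : ℝ), (∀ t ∈ Set.Icc (-1 : ℝ) (-(c ^ 2)⁻¹), ∀ x, ‖v t x‖ ≤ M) → (∀ t ∈ Set.Icc (-1 : ℝ) (-(c ^ 2)⁻¹), ∀ x, c ^ k₀ ≤ ‖x‖ → ‖x‖ * ‖v t x‖ ≤ K) → ∃ C₀ : ℝ, (∀ t ∈ Set.Icc (-1 : ℝ) (-(c ^ 2)⁻¹), ∀ x, ‖v t x‖ ≤ C₀ / (‖x‖ + Real.sqrt (-t))) := by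
  sorry

/-- **Composition: the two stubs imply the piece `TwistedCellDecay`.** -/
theorem TwistedCellDecay_of (h₁ : Registered.stub_eventual_shell_regularity)
    (h₂ : Registered.stub_decay_of_eventual) : TwistedCellDecay := by
  dsimp only [Registered.stub_eventual_shell_regularity, EventualShellRegularity,
    Registered.stub_decay_of_eventual, DecayOfEventual] at h₁ h₂
  intro c hc R hR v hcell
  obtain ⟨k₀, K, hfar⟩ := h₁ c hc R hR v hcell
  obtain ⟨M, hM⟩ := hcell.2.1
  exact h₂ c hc v M k₀ K hM hfar

/-- Wiring check: the literal stubs feed the composition. -/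
theorem twistedCellDecay_of_stubs : TwistedCellDecay :=
  TwistedCellDecay_of stub_eventual_shell_regularity stub_decay_of_eventual

end Summit.NavierStokesRegularity.NavierStokesRegularity.Cruxes.TwistedCellDecay.NoSatellites

end
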